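import Summits.BirchSwinnertonDyer.Rank1Residual.P2.CongruentNumberOneFiveMonskyDescent
import Literature.NumberTheory.EllipticCurves.Tian2014.CMPointSystemDescentOneThree
import HarnessLib

/-!
# Cell «bsd-monsky» (prover-A, g14): ROUTE A ON `N = 2p₁p₃` WITH `(p₁/p₃) = −1` (Monsky's Thm. 5.14 (14) / Cor. 5.15 (3);
# Tian's Thm. 4.5 at `k = 1`) from the cell's printed `n ≡ 3 (mod 4)` CM-point system plus Tian's printed divisibility
# sentence: rank `E_{2p₀p₁}(ℚ) = 1`, `2p₀p₁` congruent, `Ш[2^∞] = 0`, odd index of `y_{2p₀p₁}`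

HONEST FRAMING (cell `bsd-monsky`, run/shared/lean/pub/bsd-monsky/, README §1: ONE theorem on ONE explicit infinite
family at the prime `2`; nothing booked). This file asserts NO arithmetic fact and claims NOTHING new on paper: that
`2p₁p₃` is a congruent number when `(p₁/p₃) = −1` is Monsky 1990 Thm. 5.14 (14) (via Thm. 5.9) / Cor. 5.15 (3) and Tian
2014 Thm. 4.5 at `k = 1`. It records the consequences of the transplant `Tian2014/CMPointSystemDescentOneThree.lean` —
TIAN'S route, on the SAME system `CMPointData` as the cell's enclosure — from the PRINTED BINDER
`hSk₁₃ : ∀ p₀ ≡ 3, p₁ ≡ 1 (8) primes with (p₁/p₀) = −1, ∃ D : CMPointData (p₀p₁), D.Printed ∧ (σ_{1+ϖ} fixes √2) ∧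
  ∃ θ₁ = √p₁ ∈ H, σ_{1+ϖ} θ₁ = θ₁ ∧ ∃ B, B² = 1 ∧ B ∉ {1, [ϖ′]} ∧ σ_B θ₁ = −θ₁ ∧ (∀ B-stable transversals φ, y_{2p₀,φ} ∈ 2E(ℚ(√−2p₀))⁻ + E[2])`
— Tian 2014 Thm. 2.8, (4.8), the Galois facts (the displays of `CMPointSystemDisplays`), g13's sentence "`σ_{1+ϖ}` moves `i`
but fixes `√2`", the §4.2 sentences "`√p₁ ∈ H₀ ⊂ H`" (fixed by `σ_{1+ϖ}`) and on the ambiguous class `[ϖ′_{p₁}]` (an element of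
`𝒜[2] ∖ {1, [ϖ′]}` with `χ_{2p₀}([ϖ′_{p₁}]) = −1`, Lemma 4.9's "`0` otherwise"), and the ONE ANALYTIC sentence of Tian's
induction step, "(2) for each positive `d` with `2p₀ | d | 2n` and `d ≠ 2n`, `y_d ∈ 2^k E(ℚ(√−d))⁻ + E[2]`" (p0027 L1–L4, by
Thm. 3.3 = Kolyvagin + the generalised Gross–Zagier formula + `2`-adic valuations of special `L`-values) — binder form, no
new named fact; no `2`-Selmer display, no genus display. "`#(2𝒜)` odd" (Tian's (1.1) at `k = 1`, the graph condition) and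
"`#𝒜[2] = 4`" are KERNEL THEOREMS of Rédei–Reichardt + Gauss in the tree:
* (M-y) a `B`-stable transversal `φ` and a RATIONAL point `y″ ∈ E_{2p₀p₁}(ℚ)` with `transfer y″ = y_{2p₀p₁,φ}` (Monsky
  Thm. 4.7 / Lemma 4.9 (1)) and `y″ ∉ 2E_{2p₀p₁}(ℚ) + tor`
  (`Tian2014.CMPointData.exists_isReps_isStableUnder_transfer_eq_yPoint_not_two_smul_add_torsion_three_one`);
* rank `E_{2p₀p₁}(ℚ) = 1` (`y″` non-torsion; `≤ 1` = «`S̄ = ℤ/2`» on the Cor. 5.15 family `2p₁p₃`, the tree's exact count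
  `#Sel₂ = 8`, p528474); `2p₀p₁` is a congruent number; `Ш[2^∞] = 0`; `y″` has ODD INDEX against every generator.
In the tree this family was reached through «`Σ₂′` odd» and DOOR B6 (relative to {`U⁺`, GZK}; g11's `Cor515Displays`);
Monsky's own proof (Thm. 5.9 (1)) needs the real-locus Lemma 5.6, off the skeleton (g10) — Tian's route reaches it with the
analytic sentence displayed. Nothing is asserted unconditionally beyond the tree's own descent theorems.
[cite: Tian2014, Thm. 4.5 (arXiv:1210.8231 p0023 L8–L14), Lemma 4.9 (p0026 L88–L108), proof of Thm. 4.5 (p0026 L109–p0027 L20)]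
[cite: Monsky1990MockHeegner, Thm. 5.9 (1) (pp. 63–64), Thm. 5.14 (14), Cor. 5.15 (3) (p. 66), Remark (2) (p. 67)]
[cite: SilvermanAEC2009, Thm. X.4.2] [cite: TopYui2008Congruent, Prop. 3.3 (i) ⟺ (iv)]
-/

noncomputable section

open scoped Classical NumberTheorySymbols

open WeierstrassCurve NumberField Literature.NumberTheory.EllipticCurves
  Literature.NumberTheory.EllipticCurves.Rank1Residual
  Literature.NumberTheory.EllipticCurves.Rank1Residual.Typed
  Literature.NumberTheory.EllipticCurves.Monsky1990
  Literature.NumberTheory.EllipticCurves.TianYuanZhang2017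
  Literature.GroupTheory.FiniteAbelian

set_option autoImplicit false

namespace Summit.BirchSwinnertonDyer.Rank1Residual.P2

open Conjectures Literature.NumberTheory.EllipticCurves.Tian2014

/-! ## §1 The family `2p₁p₃` with `(p₁/p₃) = −1` is a Cor. 5.15 family -/

/-- **`2p₀p₁` with `p₀ ≡ 3`, `p₁ ≡ 1 (8)` primes and `(p₁/p₀) = −1` is Monsky's family `2p₁p₃` of Cor. 5.15 (3)**.
[cite: Monsky1990MockHeegner, Cor. 5.15 (3) (p. 66)] -/
theorem isCor515Family_two_one_three {p₀ p₁ : ℕ} (hp₀ : p₀.Prime) (hp₁ : p₁.Prime) (h₀3 : p₀ % 8 = 3)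
    (h₁1 : p₁ % 8 = 1) (hj : jacobiSym (p₁ : ℤ) p₀ = -1) : IsCor515Family (2 * (p₀ * p₁)) :=
  Or.inr (Or.inr (Or.inr (Or.inr (Or.inr ⟨p₁, p₀, hp₁, hp₀, h₁1, Or.inr h₀3, hj, by rw [mul_comm p₀ p₁]⟩))))

/-! ## §2 The printed binder and the consequences -/

/-- **Rank `E_{2p₀p₁}(ℚ) = 1` on the family `2p₁p₃`, `(p₁/p₃) = −1`, from the printed binder** (Tian Thm. 4.5 at `k = 1`
transplanted: `y_{2p₀p₁}` is the transfer of a rational point `y″ ∉ 2E + tor`, so `rank ≥ 1`; `rank ≤ 1` is the tree's exact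
count `#Sel₂ = 8` on the Cor. 5.15 family). The analytic input is the displayed sentence `hDiv` inside the binder.
[cite: Tian2014, Thm. 4.5 (p0023 L8–L14)] [cite: Monsky1990MockHeegner, Thm. 5.14 (14), Cor. 5.15 (3) (p. 66)]
[cite: SilvermanAEC2009, Thm. X.4.2] -/
theorem mordellWeilRank_eq_one_two_one_three_of_printed
    (hSk₁₃ : ∀ p₀ p₁ : ℕ, (hp₀ : p₀.Prime) → (hp₁ : p₁.Prime) → p₀ % 8 = 3 → p₁ % 8 = 1 →
      jacobiSym (p₁ : ℤ) p₀ = -1 →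
      ∃ D : CMPointData (p₀ * p₁), D.Printed ∧ (∀ s : D.H, s ^ 2 = 2 → D.tau s = s) ∧
        ∃ (θ₁ : D.H) (hθ₁ : θ₁ ^ 2 = (p₁ : D.H)), D.tau θ₁ = θ₁ ∧
          ∃ B : ClassGroup (𝓞 (GenusField (2 * (p₀ * p₁)))), B * B = 1 ∧ B ≠ 1 ∧ B ≠ D.piPrime ∧
            D.art B θ₁ = -θ₁ ∧
            ∀ φ : Finset (ClassGroup (𝓞 (GenusField (2 * (p₀ * p₁))))), D.IsRepsModPiPrime φ →
              IsStableUnder B φ →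
              ∃ (w : (congruentNumberCurve (2 * p₀)).toAffine.Point) (T' : EPoint D.H), (2 : ℕ) • T' = 0 ∧
                D.yPointChi (D.sqrtNegTwoN / θ₁) φ =
                  transferE (2 * p₀) (D.sqrtNegTwoN / θ₁) (D.div_sq_eq_neg rfl hp₁.ne_zero hθ₁)
                    (D.div_ne_zero' (Nat.mul_ne_zero hp₀.ne_zero hp₁.ne_zero) hp₁.ne_zero hθ₁)
                    ((2 : ℕ) • w) + T') :
    ∀ p₀ p₁ : ℕ, p₀.Prime → p₁.Prime → p₀ % 8 = 3 → p₁ % 8 = 1 → jacobiSym (p₁ : ℤ) p₀ = -1 →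
      (congruentNumberCurve (2 * (p₀ * p₁))).mordellWeilRank = 1 := by
  intro p₀ p₁ hp₀ hp₁ h₀3 h₁1 hj
  have hN : IsCor515Family (2 * (p₀ * p₁)) := isCor515Family_two_one_three hp₀ hp₁ h₀3 h₁1 hj
  haveI := isElliptic_congruentNumberCurve hN.ne_zero
  obtain ⟨D, hP, hτ2, θ₁, hθ₁, hτθ₁, B, hB2, hB1, hBπ, hBθ₁, hDiv⟩ := hSk₁₃ p₀ p₁ hp₀ hp₁ h₀3 h₁1 hj
  obtain ⟨φ, -, -, y'', -, hnot⟩ :=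
    D.exists_isReps_isStableUnder_transfer_eq_yPoint_not_two_smul_add_torsion_three_one rfl hp₀ hp₁ h₀3 h₁1 hj hP
      hτ2 hθ₁ hτθ₁ hB2 hB1 hBπ hBθ₁ hDiv
  exact le_antisymm (mordellWeilRank_le_one_of_isCor515Family hN)
    (Nat.one_le_iff_ne_zero.mpr (mordellWeilRank_ne_zero_of_not_two_smul_add_torsion hN.ne_zero y'' hnot))

/-- **`2p₀p₁` is a congruent number on the family `2p₁p₃`, `(p₁/p₃) = −1`, from the printed binder** (Cor. 5.15 (3)).
[cite: Tian2014, Thm. 4.5 (p0023 L8–L14)] [cite: Monsky1990MockHeegner, Cor. 5.15 (3) (p. 66)]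
[cite: TopYui2008Congruent, Prop. 3.3 (i) ⟺ (iv)] -/
theorem isCongruentNumber_two_one_three_of_printed
    (hSk₁₃ : ∀ p₀ p₁ : ℕ, (hp₀ : p₀.Prime) → (hp₁ : p₁.Prime) → p₀ % 8 = 3 → p₁ % 8 = 1 →
      jacobiSym (p₁ : ℤ) p₀ = -1 →
      ∃ D : CMPointData (p₀ * p₁), D.Printed ∧ (∀ s : D.H, s ^ 2 = 2 → D.tau s = s) ∧
        ∃ (θ₁ : D.H) (hθ₁ : θ₁ ^ 2 = (p₁ : D.H)), D.tau θ₁ = θ₁ ∧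
          ∃ B : ClassGroup (𝓞 (GenusField (2 * (p₀ * p₁)))), B * B = 1 ∧ B ≠ 1 ∧ B ≠ D.piPrime ∧
            D.art B θ₁ = -θ₁ ∧
            ∀ φ : Finset (ClassGroup (𝓞 (GenusField (2 * (p₀ * p₁))))), D.IsRepsModPiPrime φ →
              IsStableUnder B φ →
              ∃ (w : (congruentNumberCurve (2 * p₀)).toAffine.Point) (T' : EPoint D.H), (2 : ℕ) • T' = 0 ∧
                D.yPointChi (D.sqrtNegTwoN / θ₁) φ =
                  transferE (2 * p₀) (D.sqrtNegTwoN / θ₁) (D.div_sq_eq_neg rfl hp₁.ne_zero hθ₁)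
                    (D.div_ne_zero' (Nat.mul_ne_zero hp₀.ne_zero hp₁.ne_zero) hp₁.ne_zero hθ₁)
                    ((2 : ℕ) • w) + T') :
    ∀ p₀ p₁ : ℕ, p₀.Prime → p₁.Prime → p₀ % 8 = 3 → p₁ % 8 = 1 → jacobiSym (p₁ : ℤ) p₀ = -1 →
      IsCongruentNumber (2 * (p₀ * p₁)) :=
  fun p₀ p₁ hp₀ hp₁ h₀3 h₁1 hj =>
    (Wiles2000.mordellWeilRank_ne_zero_iff_isCongruentNumber
      (by have := hp₀.pos; have := hp₁.pos; positivity)).mp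
      (by rw [mordellWeilRank_eq_one_two_one_three_of_printed hSk₁₃ p₀ p₁ hp₀ hp₁ h₀3 h₁1 hj]; exact one_ne_zero)

/-- **`Ш(E_{2p₀p₁})[2^∞] = 0` on the family `2p₁p₃`, `(p₁/p₃) = −1`, from the printed binder** (rank one and the exact count
`#Sel₂ = 8`). [cite: Monsky1990MockHeegner, Remark (2) (p. 67)] [cite: SilvermanAEC2009, Thm. X.4.2] -/
theorem primaryComponent_sha_two_eq_bot_two_one_three_of_printed
    (hSk₁₃ : ∀ p₀ p₁ : ℕ, (hp₀ : p₀.Prime) → (hp₁ : p₁.Prime) → p₀ % 8 = 3 → p₁ % 8 = 1 →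
      jacobiSym (p₁ : ℤ) p₀ = -1 →
      ∃ D : CMPointData (p₀ * p₁), D.Printed ∧ (∀ s : D.H, s ^ 2 = 2 → D.tau s = s) ∧
        ∃ (θ₁ : D.H) (hθ₁ : θ₁ ^ 2 = (p₁ : D.H)), D.tau θ₁ = θ₁ ∧
          ∃ B : ClassGroup (𝓞 (GenusField (2 * (p₀ * p₁)))), B * B = 1 ∧ B ≠ 1 ∧ B ≠ D.piPrime ∧
            D.art B θ₁ = -θ₁ ∧
            ∀ φ : Finset (ClassGroup (𝓞 (GenusField (2 * (p₀ * p₁))))), D.IsRepsModPiPrime φ →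
              IsStableUnder B φ →
              ∃ (w : (congruentNumberCurve (2 * p₀)).toAffine.Point) (T' : EPoint D.H), (2 : ℕ) • T' = 0 ∧
                D.yPointChi (D.sqrtNegTwoN / θ₁) φ =
                  transferE (2 * p₀) (D.sqrtNegTwoN / θ₁) (D.div_sq_eq_neg rfl hp₁.ne_zero hθ₁)
                    (D.div_ne_zero' (Nat.mul_ne_zero hp₀.ne_zero hp₁.ne_zero) hp₁.ne_zero hθ₁)
                    ((2 : ℕ) • w) + T') :
    ∀ p₀ p₁ : ℕ, (hp₀ : p₀.Prime) → (hp₁ : p₁.Prime) → p₀ % 8 = 3 → p₁ % 8 = 1 → jacobiSym (p₁ : ℤ) p₀ = -1 →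
      haveI := isElliptic_congruentNumberCurve (n := 2 * (p₀ * p₁))
        (Nat.mul_ne_zero two_ne_zero (Nat.mul_ne_zero hp₀.ne_zero hp₁.ne_zero))
      AddCommGroup.primaryComponent (congruentNumberCurve (2 * (p₀ * p₁))).sha 2 = ⊥ := by
  intro p₀ p₁ hp₀ hp₁ h₀3 h₁1 hj
  have hN : IsCor515Family (2 * (p₀ * p₁)) := isCor515Family_two_one_three hp₀ hp₁ h₀3 h₁1 hj
  have h := (isCongruentNumber_iff_primaryComponent_sha_two_eq_bot_of_isCor515Family hN).mp
    (isCongruentNumber_two_one_three_of_printed hSk₁₃ p₀ p₁ hp₀ hp₁ h₀3 h₁1 hj)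
  convert h

/-- **TIAN'S THEOREM 4.5 AT `k = 1` / MONSKY'S THEOREM 5.14 (14) FOR TIAN'S POINT `y_{2p₀p₁}`, from the printed binder**: for
every such pair there are a printed system `D`, the §4.2 data, a `B`-stable transversal `φ`, and a rational point
`y″ ∈ E_{2p₀p₁}(ℚ)` with `transfer y″ = y_{2p₀p₁,φ}`, of INFINITE ORDER and ODD INDEX against every generator of
`E_{2p₀p₁}(ℚ)/tor` ("`y_{2n} ∉ 2E(ℚ(√−2n))⁻ + E[2]`"). No `2`-Selmer display, no genus display, no reading mark; the one
analytic sentence is displayed as printed. [cite: Tian2014, Thm. 4.5 (p0023 L8–L14)] [cite: Monsky1990MockHeegner, Thm. 5.14 (14) (p. 66)] -/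
theorem monskyOddIndex_two_one_three_of_printed
    (hSk₁₃ : ∀ p₀ p₁ : ℕ, (hp₀ : p₀.Prime) → (hp₁ : p₁.Prime) → p₀ % 8 = 3 → p₁ % 8 = 1 →
      jacobiSym (p₁ : ℤ) p₀ = -1 →
      ∃ D : CMPointData (p₀ * p₁), D.Printed ∧ (∀ s : D.H, s ^ 2 = 2 → D.tau s = s) ∧
        ∃ (θ₁ : D.H) (hθ₁ : θ₁ ^ 2 = (p₁ : D.H)), D.tau θ₁ = θ₁ ∧
          ∃ B : ClassGroup (𝓞 (GenusField (2 * (p₀ * p₁)))), B * B = 1 ∧ B ≠ 1 ∧ B ≠ D.piPrime ∧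
            D.art B θ₁ = -θ₁ ∧
            ∀ φ : Finset (ClassGroup (𝓞 (GenusField (2 * (p₀ * p₁))))), D.IsRepsModPiPrime φ →
              IsStableUnder B φ →
              ∃ (w : (congruentNumberCurve (2 * p₀)).toAffine.Point) (T' : EPoint D.H), (2 : ℕ) • T' = 0 ∧
                D.yPointChi (D.sqrtNegTwoN / θ₁) φ =
                  transferE (2 * p₀) (D.sqrtNegTwoN / θ₁) (D.div_sq_eq_neg rfl hp₁.ne_zero hθ₁)
                    (D.div_ne_zero' (Nat.mul_ne_zero hp₀.ne_zero hp₁.ne_zero) hp₁.ne_zero hθ₁)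
                    ((2 : ℕ) • w) + T') :
    ∀ p₀ p₁ : ℕ, (hp₀ : p₀.Prime) → (hp₁ : p₁.Prime) → p₀ % 8 = 3 → p₁ % 8 = 1 → jacobiSym (p₁ : ℤ) p₀ = -1 →
      ∃ D : CMPointData (p₀ * p₁), D.Printed ∧
        ∃ φ : Finset (ClassGroup (𝓞 (GenusField (2 * (p₀ * p₁))))), D.IsRepsModPiPrime φ ∧
          ∃ y'' : (congruentNumberCurve (2 * (p₀ * p₁))).toAffine.Point,
            D.transfer (Nat.mul_ne_zero hp₀.ne_zero hp₁.ne_zero) y'' = D.yPoint φ ∧ ¬ IsOfFinAddOrder y'' ∧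
            (∀ g : (congruentNumberCurve (2 * (p₀ * p₁))).toAffine.Point, GeneratesFreePartRat (2 * (p₀ * p₁)) g →
              ∃ m : ℤ, Odd m ∧ IsOfFinAddOrder (y'' - m • g)) := by
  intro p₀ p₁ hp₀ hp₁ h₀3 h₁1 hj
  obtain ⟨D, hP, hτ2, θ₁, hθ₁, hτθ₁, B, hB2, hB1, hBπ, hBθ₁, hDiv⟩ := hSk₁₃ p₀ p₁ hp₀ hp₁ h₀3 h₁1 hj
  obtain ⟨φ, hφ, -, y'', hy'', hnot⟩ :=
    D.exists_isReps_isStableUnder_transfer_eq_yPoint_not_two_smul_add_torsion_three_one rfl hp₀ hp₁ h₀3 h₁1 hj hP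
      hτ2 hθ₁ hτθ₁ hB2 hB1 hBπ hBθ₁ hDiv
  exact ⟨D, hP, φ, hφ, y'', hy'', not_isOfFinAddOrder_of_not_two_smul_add_torsion y'' hnot,
    fun g hg => exists_odd_isOfFinAddOrder_sub_zsmul_of_not_two_smul_add_torsion y'' hnot g hg⟩

end Summit.BirchSwinnertonDyer.Rank1Residual.P2

end
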